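import Literature.MathematicalPhysics.QuantumFieldTheory.Balaban1983to89.Node00.OpsYExpsOfRecordV3
import Literature.MathematicalPhysics.QuantumFieldTheory.Balaban1983to89.B9Thm311ReadingAtLettersQ

/-!
# `Balaban1983to89.Node00.OpsYExpsOfRecordV3Par` — T. Bałaban, *Propagators for lattice gauge theories in a background field*, Commun. Math. Phys. **99**
# (1985) 389–434 [Balaban1985BackgroundPropagators], Thms 3.7–3.13 pp. 409–426, Thm 3.11 p. 416 + (3.24)–(3.27) pp. 394–395, (3.95) p. 411, (3.19) p. 393,
# (3.40) p. 397, (3.35)–(3.36) p. 396: THE EXPANSION-LETTER RECORD `𝔈` OF STAGE 3′(Y) OVER A LETTER FAMILY `𝔏`, AN AVERAGING TRANSPORTER `parA`, A HÖLDER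
# TRANSPORTER `parH` AND AN AVERAGING PAIR `(𝔮, 𝔮⋆)` AS PARAMETERS — `expsYOfRecordV3Par`, the constructor-free pins `pinsE_of_eq`, and
# `expsYOfRecordV3 … 𝔯 … = expsYOfRecordV3Par … (lettersYOfRecordV4P … 𝔯) … parSymY parSymY (QY parBY) (QsY parBY) …` (`rfl`)

statement-level skeleton of published theorems with citation tags; proofs where landed; nothing here is a claim about the Yang–Mills mass gap

WHY (cell context; CASCADE-K, director-ym №383, piece W2; node00-def-Y's transporter ruling 2026-08-30).  `Node00.OpsYExpsOfRecordV3` (✓, seat n06-d g23) builds the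
seven pinned expansion fields from the v4P letters of record `lettersYOfRecordV4P … 𝔯` and the symmetrised transporter `parSymY` in three roles at once — inside the
walk letters and the one-cube letter `L` of (3.95) (AVERAGING, contours (3.21)), in the `G′` kernel family of Thm 3.7's residual (HÖLDER, contours (3.40)) — and Thm 3.11's
operators `ops311Y` (straight-contour `Δ_a`).  At the knit letters of record (`Node00.OpsYRecordV11.lettersYOfRecordV11K`: `parS = parKnitY`, `G = G[Qknit]`, node00-def-Y)
the roles separate: averaging = `parKnitY`, Hölder = `parSymY`, `Δ_a = Δ_a^{Qknit}`.  This file is the ONE parametric re-press: `𝔏`, `parA`, `parH`, `(𝔮, 𝔮⋆)` are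
parameters (every other slot verbatim), and the seven pins are stated ON THE FIELDS OF `𝔈` so that every operator-layer constructor reads them by structure projection
(no instance is compared with another — dag-n06-d g24's located `whnf` time-out).

WHAT IS IN THE FILE (1 `def`, 0 `sorry`; standard axioms).
* ★★ `expsYOfRecordV3Par N θ M⋆ 𝔏 𝔈₀ R₁ R₂ bI parA parH 𝔮 𝔮s α′ r39 B39 p q p3 q3 pM qM H O near 𝔬A rdA 𝔬12`.
* ★ `expsYOfRecordV3_eq_par` — today's record IS the instance `(lettersYOfRecordV4P … 𝔯, parSymY, parSymY, QY parBY, QsY parBY)` (`rfl`).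
* ★★★ `pinsE_of_eq` — the seven pins from `h𝔈 : 𝔈 = expsYOfRecordV3Par …` on `(𝔈 x).EK39 ∕ .PosDef ∕ .E37 ∕ .E310 ∕ .HasRWExp ∕ .HasRWExpH ∕ .PosDefK` (`subst; rfl`).

HONEST SCOPE.  Bookkeeping (a record constructor and `rfl` faces); nothing of [B9] is asserted; COUNT-NEUTRAL; N06 NOT discharged; one finite lattice programme at
fixed `ε` — nothing continuum ∕ OS ∕ mass-gap ∕ Clay.  Cell `pub-ymgap` (HUMAN RULING D-0062), Track A node N06 [B9], seat `pub-ymgap-dag-n06-d` (g25), 2026-08-30.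
RELATED, NOT DUPLICATED: `Node00.OpsYExpsOfRecordV3` (the v4P record and its faces, USED BY NAME), `Node00.OpsYExpsOfRecordV2` (the re-typing helpers
`rwExpansionRY ∕ rwKernelExpansionRY`), `B9Thm311ReadingAtLettersQ` (`ops311YQ`), `B9Thm39OneCubeReadingAtLettersY` (`oneCubeOps39`), `B9Thm39ReadingAtLetters` (`L39`);
rows 15∕16 over this `EK39` are `B9Thm39FacesAtLettersRCPar.t39_hksum_oneCube_opsYOfLetters_FRC_par`; the `G′`-slot constructor is node00-def-Y's `Node00.OpsYRecordV11SH`.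
-/

noncomputable section

namespace Literature.MathematicalPhysics.QuantumFieldTheory.Balaban1983to89.Node00.OpsYExpsOfRecordV3Par

open Node00.OpsYExpsOfRecordV3 (expsYOfRecordV3)
open B9Ineq349SiteReading (opsYS349OfLetters)
open B9Eq3132NuReading (opsYS349NuOfLetters)
open Node00
open B9PinMembersKLevelV1 (MemberY geo9Y bg9Y)
open B9BackgroundsKLevelV1R (RegFamY bg9YR regY335 regY336 kernelFamilyR rwExpansionR rwKernelExpansionR)
open B9OpsRTransport (ops312RY)
open B7Prop2SpecialUnitary (specialUnitaryUnits)
open B6Cover236MultiLevelBlocks (cubes)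
open B9Thm37Whole (Ops)
open B9Cor38Whole (WalkReading)
open B9Thm310Whole (Ops310 WalkReading310)
open B9Thm311Whole (PosDefOfOps)
open B9Thm311ReadingAtLetters (ops311Y)
open B9Thm311ReadingAtLettersQ (ops311YQ)
open B9Thm311PosAtRecordV4 (proofLettersGA)
open B9Thm39WholeBlkViaDatum (EK39OfOpsBlkVia)
open B9Thm39ReadingFaithful (repSite39F)
open B9Thm39OneCubeReadingAtLettersY (oneCubeReading39 oneCubeOps39)
open B9Thm39ReadingAtLetters (L39)
open B9Ineq349SiteFromConv348 (blk39F)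
open B9Thm39PureGaugeClassAtLettersR (oneCubeOps39YFR)
open B9RowSum261DefiniteFaces (rowConst261)
open B9Thm312Whole (HasRWExpOfOps HasRWExpHOfOps PosDefKOfOps)
open B9RWSumsDefinitePins (PinPrims)
open B9RWSumsDefinitePinsPair (PairPrims)
open B9RWSumsDefinitePinsPairM (MixedPrims E310YPairM)
open B9RWSumsDefinitePinsPairMDir (E37YPairMDir)
open B9CoReadingCoordsTranspose (TrIdx trBasis)
open B9CoReadingCoords (XBK)
open B9CoReadingCoordsS (XSK)
open B9CoReadingCoordsH (XHK)
open B9GeoNbrCountKLevelV1 (nbrCountY)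
open scoped Matrix.Norms.L2Operator
open B9WalkLettersOps (nearDomY)
open B9WalkLettersOpsO (opsWalkYO dirOpsWalkYO dirLettersWalkYO rdWalkYO)
open B9WalkLettersCoordsS (cubeDomY)
open Node00.OpsYLocalInverse (GsqY)

/-! ## §1 ★★ The expansion-letter record over a letter family `𝔏`, an averaging transporter `parA`, a Hölder transporter `parH` and an averaging pair `(𝔮, 𝔮s)` -/

section Defn

/-- ★★ **THE EXPANSION LETTERS OF RECORD OVER A LETTER FAMILY, AN AVERAGING TRANSPORTER, A HÖLDER TRANSPORTER AND AN AVERAGING PAIR**: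
`Node00.OpsYExpsOfRecordV3.expsYOfRecordV3` with the v4P letters of record replaced by the parameter `𝔏`, the walk letters' transporter and Thm 3.9's one-cube letter
`L = Q′G′²Q′*` of (3.95) read at the AVERAGING transporter `parA x` (`opsWalkYO … (parA x) …`, `oneCubeOps39 … (L39 x (parA x) (𝔏 x).Gp)`), Thm 3.11's five operators read with
`Δ_a^Q = deltaAQY x (𝔮 x) (𝔮s x) (parA x) (𝔏 x).Gp` (dag-n06-j's `ops311YQ`), and Thm 3.7's `PairM` expansion stated against the `G′` kernel family with HÖLDER transporter `parH x`
(`kernelFamilyS … (𝔏 x).Gp (parH x)` — node00-def-Y's ruling: the letter `parS` is the averaging transporter, the Hölder transporter of (3.40) enters as a binder at the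
`G′` slot, `Node00.OpsYRecordV11SH.opsYS349NuOfLettersH`); every other slot verbatim.
[cite: Balaban1985BackgroundPropagators, Thm 3.7 (3.90) p.409 + Cor. 3.8 (3.93)–(3.94) p.410, Thm 3.9 (3.98)–(3.99) pp.412–413 + (3.95) p.411, Thm 3.10 (3.107)–(3.108)
pp.415–416, Thm 3.11 p.416 + (3.24)–(3.27) pp.394–395, Thm 3.12 p.423, Thm 3.13 p.426, (3.19) p.393, (3.40) p.397, (3.35)–(3.36) p.396 (the class as a parameter)] -/
def expsYOfRecordV3Par (N : ℕ) (θ : Stage3Params) (Mstar : ℕ) (𝔏 : LettersY N θ Mstar) (𝔈₀ : ExpsY N θ Mstar)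
    [∀ x : MemberY θ.d₆ θ.ℓ₆ θ.hd' θ.hL' θ.b₀ θ.b₁ Mstar, Fintype (geo9Y x).Site]
    [∀ x : MemberY θ.d₆ θ.ℓ₆ θ.hd' θ.hL' θ.b₀ θ.b₁ Mstar, DecidableEq (geo9Y x).Site]
    (R₁ R₂ : RegFamY θ.d₆ θ.ℓ₆ θ.hd' θ.hL' θ.b₀ θ.b₁ Mstar (Matrix (Fin N) (Fin N) ℂ))
    (bI : ∀ x : MemberY θ.d₆ θ.ℓ₆ θ.hd' θ.hL' θ.b₀ θ.b₁ Mstar, FBondY x.toKIdx → IBondY x.toKIdx)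
    (parA : ∀ x : MemberY θ.d₆ θ.ℓ₆ θ.hd' θ.hL' θ.b₀ θ.b₁ Mstar, SiteParY (Matrix (Fin N) (Fin N) ℂ) x.toKIdx)
    (parH : ∀ x : MemberY θ.d₆ θ.ℓ₆ θ.hd' θ.hL' θ.b₀ θ.b₁ Mstar, SiteParY (Matrix (Fin N) (Fin N) ℂ) x.toKIdx)
    (𝔮 : ∀ x : MemberY θ.d₆ θ.ℓ₆ θ.hd' θ.hL' θ.b₀ θ.b₁ Mstar, CfgY (Matrix (Fin N) (Fin N) ℂ) x.toKIdx →
      ((FBondY x.toKIdx → Matrix (Fin N) (Fin N) ℂ) →ₗ[ℂ] (IBondY x.toKIdx → Matrix (Fin N) (Fin N) ℂ)))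
    (𝔮s : ∀ x : MemberY θ.d₆ θ.ℓ₆ θ.hd' θ.hL' θ.b₀ θ.b₁ Mstar, CfgY (Matrix (Fin N) (Fin N) ℂ) x.toKIdx →
      ((IBondY x.toKIdx → Matrix (Fin N) (Fin N) ℂ) →ₗ[ℂ] (FBondY x.toKIdx → Matrix (Fin N) (Fin N) ℂ)))
    (α' r39 B39 : ℝ) (p q : PinPrims)
    (p3 q3 : PairPrims) (pM qM : MixedPrims) (H : MemberY θ.d₆ θ.ℓ₆ θ.hd' θ.hL' θ.b₀ θ.b₁ Mstar → Prop)
    (O : ∀ x : MemberY θ.d₆ θ.ℓ₆ θ.hd' θ.hL' θ.b₀ θ.b₁ Mstar, ↥(cubes x.toKIdx.D.toDomains) → SiteOpY (Matrix (Fin N) (Fin N) ℂ) x.toKIdx)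
    (near : ∀ x : MemberY θ.d₆ θ.ℓ₆ θ.hd' θ.hL' θ.b₀ θ.b₁ Mstar, ↥(cubes x.toKIdx.D.toDomains) → Finset (SiteY x.toKIdx))
    {ιA AA : MemberY θ.d₆ θ.ℓ₆ θ.hd' θ.hL' θ.b₀ θ.b₁ Mstar → Type} [∀ x, Fintype (ιA x)] [∀ x, Fintype (AA x)]
    (𝔬A : ∀ x : MemberY θ.d₆ θ.ℓ₆ θ.hd' θ.hL' θ.b₀ θ.b₁ Mstar, Ops310 (geo9Y x)
      (bg9YR (Matrix (Fin N) (Fin N) ℂ) (specialUnitaryUnits (Fin N)) R₁ R₂ x) (XBK (TrIdx N) x.toKIdx) (XBK (TrIdx N) x.toKIdx) (ιA x) (AA x))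
    (rdA : ∀ x : MemberY θ.d₆ θ.ℓ₆ θ.hd' θ.hL' θ.b₀ θ.b₁ Mstar, WalkReading310 (geo9Y x)
      (bg9YR (Matrix (Fin N) (Fin N) ℂ) (specialUnitaryUnits (Fin N)) R₁ R₂ x) (XBK (TrIdx N) x.toKIdx) (ιA x) (AA x))
    (𝔬12 : ∀ x : MemberY θ.d₆ θ.ℓ₆ θ.hd' θ.hL' θ.b₀ θ.b₁ Mstar, B9Thm312Whole.Ops (geo9Y x)
      (bg9YR (Matrix (Fin N) (Fin N) ℂ) (specialUnitaryUnits (Fin N)) R₁ R₂ x) (XBK (TrIdx N) x.toKIdx) (XBK (TrIdx N) x.toKIdx) (XHK (TrIdx N) x.toKIdx)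
      (XSK (TrIdx N) x.toKIdx)) :
    ExpsY N θ Mstar := fun x =>
  { 𝔈₀ x with
    EK39 := OpsYExpsOfRecordV2.rwKernelExpansionRY
      (EK39OfOpsBlkVia (oneCubeOps39 (geo9Y x) (bg9YR (Matrix (Fin N) (Fin N) ℂ) (specialUnitaryUnits (Fin N)) R₁ R₂ x)
          (blk39F (Matrix (Fin N) (Fin N) ℂ) x.toKIdx (bI x)) (L39 x.toKIdx (parA x) (𝔏 x).Gp)) (oneCubeReading39 _) (θ.d₆ + 1)
        (2 * (1 * B39) * rowConst261 (geo9Y (d := θ.d₆) (ℓ := θ.ℓ₆) (hd := θ.hd') (hL := θ.hL') (b₀ := θ.b₀) (b₁ := θ.b₁) (Mstar := Mstar)) (α' * r39))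
        ((1 - α') * r39) (repSite39F x.toKIdx (bI x)))
    PosDef := PosDefOfOps (ops311YQ x (𝔏 x) (parA x) (𝔮 x) (𝔮s x) (proofLettersGA (𝔏 x)))
    E37 := OpsYExpsOfRecordV2.rwExpansionRY
      (E37YPairMDir (bg := (bg9YR (Matrix (Fin N) (Fin N) ℂ) (specialUnitaryUnits (Fin N)) R₁ R₂)) (2 * (θ.d₆ + 1))
        (nbrCountY θ.d₆ θ.ℓ₆ θ.hd' θ.hL' θ.b₀ θ.b₁ 2) (Real.sqrt ((θ.d₆ + 1) * Fintype.card (TrIdx N))) ((θ.d₆ + 1 : ℕ) : ℝ) p q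
        (⟨p3.N3, 2 * p3.B3, 0⟩ : PairPrims) (⟨q3.N3, 2 * q3.B3, 0⟩ : PairPrims) pM qM
        (opsWalkYO x (trBasis N) (bg9YR (Matrix (Fin N) (Fin N) ℂ) (specialUnitaryUnits (Fin N)) R₁ R₂ x) (fun U => U) (parA x) (bI x) (O x))
        (dirOpsWalkYO x (trBasis N) (bg9YR (Matrix (Fin N) (Fin N) ℂ) (specialUnitaryUnits (Fin N)) R₁ R₂ x) (fun U => U) (parA x) (bI x) (O x))
        (dirLettersWalkYO x (trBasis N) (bg9YR (Matrix (Fin N) (Fin N) ℂ) (specialUnitaryUnits (Fin N)) R₁ R₂ x) (fun U => U) (parA x) (bI x) (O x))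
        (rdWalkYO x (bg9YR (Matrix (Fin N) (Fin N) ℂ) (specialUnitaryUnits (Fin N)) R₁ R₂ x) (fun U => U) (parA x) (near x)) (H x)
        (kernelFamilyR R₁ R₂
          (kernelFamilyS x.toKIdx (bg9Y (Matrix (Fin N) (Fin N) ℂ) (specialUnitaryUnits (Fin N)) x) (fun U => U) (𝔏 x).Gp
            (parH x))))
    E310 := OpsYExpsOfRecordV2.rwExpansionRY
      (E310YPairM (bg := (bg9YR (Matrix (Fin N) (Fin N) ℂ) (specialUnitaryUnits (Fin N)) R₁ R₂)) (2 * (θ.d₆ + 1))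
        (nbrCountY θ.d₆ θ.ℓ₆ θ.hd' θ.hL' θ.b₀ θ.b₁ 2) (Real.sqrt ((θ.d₆ + 1) * Fintype.card (TrIdx N))) ((θ.d₆ + 1 : ℕ) : ℝ) p q
        (⟨p3.N3, 2 * p3.B3, 0⟩ : PairPrims) (⟨q3.N3, 2 * q3.B3, 0⟩ : PairPrims) pM qM (𝔬A x) (rdA x) (H x)
        (kernelFamilyR R₁ R₂
          (kernelFamilyB x.toKIdx (bg9Y (Matrix (Fin N) (Fin N) ℂ) (specialUnitaryUnits (Fin N)) x) (fun U => U) (𝔏 x).GA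
            (𝔏 x).parB)))
    HasRWExp := HasRWExpOfOps (ops312RY (𝔬12 x))
    HasRWExpH := HasRWExpHOfOps (ops312RY (𝔬12 x))
    PosDefK := PosDefKOfOps (ops312RY (𝔬12 x)) }

end Defn

/-! ## §2 ★ Today's record is the instance `(lettersYOfRecordV4P … 𝔯, parSymY, parSymY, QY parBY, QsY parBY)`; ★★★ the seven pins on the fields of `𝔈` -/

section Faces

variable (N : ℕ) (θ : Stage3Params) (Mstar : ℕ) (𝔏 : LettersY N θ Mstar) (𝔈₀ : ExpsY N θ Mstar)
  [∀ x : MemberY θ.d₆ θ.ℓ₆ θ.hd' θ.hL' θ.b₀ θ.b₁ Mstar, Fintype (geo9Y x).Site]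
  [∀ x : MemberY θ.d₆ θ.ℓ₆ θ.hd' θ.hL' θ.b₀ θ.b₁ Mstar, DecidableEq (geo9Y x).Site]
  (R₁ R₂ : RegFamY θ.d₆ θ.ℓ₆ θ.hd' θ.hL' θ.b₀ θ.b₁ Mstar (Matrix (Fin N) (Fin N) ℂ))
  (bI : ∀ x : MemberY θ.d₆ θ.ℓ₆ θ.hd' θ.hL' θ.b₀ θ.b₁ Mstar, FBondY x.toKIdx → IBondY x.toKIdx)
  (parA : ∀ x : MemberY θ.d₆ θ.ℓ₆ θ.hd' θ.hL' θ.b₀ θ.b₁ Mstar, SiteParY (Matrix (Fin N) (Fin N) ℂ) x.toKIdx)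
  (parH : ∀ x : MemberY θ.d₆ θ.ℓ₆ θ.hd' θ.hL' θ.b₀ θ.b₁ Mstar, SiteParY (Matrix (Fin N) (Fin N) ℂ) x.toKIdx)
  (𝔮 : ∀ x : MemberY θ.d₆ θ.ℓ₆ θ.hd' θ.hL' θ.b₀ θ.b₁ Mstar, CfgY (Matrix (Fin N) (Fin N) ℂ) x.toKIdx →
    ((FBondY x.toKIdx → Matrix (Fin N) (Fin N) ℂ) →ₗ[ℂ] (IBondY x.toKIdx → Matrix (Fin N) (Fin N) ℂ)))
  (𝔮s : ∀ x : MemberY θ.d₆ θ.ℓ₆ θ.hd' θ.hL' θ.b₀ θ.b₁ Mstar, CfgY (Matrix (Fin N) (Fin N) ℂ) x.toKIdx →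
    ((IBondY x.toKIdx → Matrix (Fin N) (Fin N) ℂ) →ₗ[ℂ] (FBondY x.toKIdx → Matrix (Fin N) (Fin N) ℂ)))
  (α' r39 B39 : ℝ) (p q : PinPrims)
  (p3 q3 : PairPrims) (pM qM : MixedPrims) (H : MemberY θ.d₆ θ.ℓ₆ θ.hd' θ.hL' θ.b₀ θ.b₁ Mstar → Prop)
    (O : ∀ x : MemberY θ.d₆ θ.ℓ₆ θ.hd' θ.hL' θ.b₀ θ.b₁ Mstar, ↥(cubes x.toKIdx.D.toDomains) → SiteOpY (Matrix (Fin N) (Fin N) ℂ) x.toKIdx)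
    (near : ∀ x : MemberY θ.d₆ θ.ℓ₆ θ.hd' θ.hL' θ.b₀ θ.b₁ Mstar, ↥(cubes x.toKIdx.D.toDomains) → Finset (SiteY x.toKIdx))
  {ιA AA : MemberY θ.d₆ θ.ℓ₆ θ.hd' θ.hL' θ.b₀ θ.b₁ Mstar → Type} [∀ x, Fintype (ιA x)] [∀ x, Fintype (AA x)]
  (𝔬A : ∀ x : MemberY θ.d₆ θ.ℓ₆ θ.hd' θ.hL' θ.b₀ θ.b₁ Mstar, Ops310 (geo9Y x)
    (bg9YR (Matrix (Fin N) (Fin N) ℂ) (specialUnitaryUnits (Fin N)) R₁ R₂ x) (XBK (TrIdx N) x.toKIdx) (XBK (TrIdx N) x.toKIdx) (ιA x) (AA x))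
  (rdA : ∀ x : MemberY θ.d₆ θ.ℓ₆ θ.hd' θ.hL' θ.b₀ θ.b₁ Mstar, WalkReading310 (geo9Y x)
    (bg9YR (Matrix (Fin N) (Fin N) ℂ) (specialUnitaryUnits (Fin N)) R₁ R₂ x) (XBK (TrIdx N) x.toKIdx) (ιA x) (AA x))
  (𝔬12 : ∀ x : MemberY θ.d₆ θ.ℓ₆ θ.hd' θ.hL' θ.b₀ θ.b₁ Mstar, B9Thm312Whole.Ops (geo9Y x)
    (bg9YR (Matrix (Fin N) (Fin N) ℂ) (specialUnitaryUnits (Fin N)) R₁ R₂ x) (XBK (TrIdx N) x.toKIdx) (XBK (TrIdx N) x.toKIdx) (XHK (TrIdx N) x.toKIdx)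
    (XSK (TrIdx N) x.toKIdx))

/-- ★ **TODAY's RECORD IS THE INSTANCE** `(𝔏, parA, parH, 𝔮, 𝔮s) := (lettersYOfRecordV4P … 𝔯, parSymY, parSymY, QY parBY, QsY parBY)` of the parametric one (`rfl`; dag-n06-j's `ops311YQ_QY`; at the straight record the two transporter roles coincide). [cite: Balaban1985BackgroundPropagators, (3.19) p.393, (3.35) p.396, bookkeeping] -/
theorem expsYOfRecordV3_eq_par (𝔯 : ResY N θ Mstar) :
    expsYOfRecordV3 N θ Mstar 𝔯 𝔈₀ R₁ R₂ bI α' r39 B39 p q p3 q3 pM qM H O near 𝔬A rdA 𝔬12 =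
      expsYOfRecordV3Par N θ Mstar (lettersYOfRecordV4P N θ Mstar 𝔯) 𝔈₀ R₁ R₂ bI (fun x => parSymY x.toKIdx) (fun x => parSymY x.toKIdx)
        (fun x => QY x.toKIdx (parBY x.toKIdx)) (fun x => QsY x.toKIdx (parBY x.toKIdx)) α' r39 B39 p q p3 q3 pM qM H O near 𝔬A rdA 𝔬12 := rfl

variable {N θ Mstar 𝔏 𝔈₀ R₁ R₂ bI parA parH 𝔮 𝔮s α' r39 B39 p q p3 q3 pM qM H O near 𝔬A rdA 𝔬12}

/-- ★★★ **THE SEVEN PINS FROM ONE EQUATION, ON THE FIELDS OF `𝔈` (constructor-free)**: if `𝔈 = expsYOfRecordV3Par … 𝔏 … parA parH 𝔮 𝔮s …` then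
`(𝔈 x).EK39 ∕ .PosDef ∕ .E37 ∕ .E310 ∕ .HasRWExp ∕ .HasRWExpH ∕ .PosDefK` are, literally, the Thm-3.9 expansion over the one-cube letter `L = Q′(parA)G′²Q′*(parA)`, Thm 3.11's
positivity field over `Δ_a^Q` at `(parA, 𝔮, 𝔮s)`, the `PairM` expansions of Thms 3.7 ∕ 3.10 over the walk letters at `parA` against the kernel families of `G′` (Hölder
transporter `parH x`) and `G` (`(𝔏 x).parB`), and Thm 3.12's three slots over `ops312RY (𝔬12 x)` — at EVERY operator-layer constructor whose expansion ∕ predicate slots are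
`𝔈`'s (`opsYOfLetters`, `opsYS349[Nu]OfLetters[H]`, `opsYSectESt …`: structure projections), in particular at node00-def-Y's `opsYSectESt … (opsYS349NuOfLettersH … 𝔏 parH 𝔈) 𝔏 𝔢 𝔴`
whose `G′` slot IS `kernelFamilyS … (𝔏 x).Gp (parH x)` (the knit certificate's `obtain` line; `subst; rfl`).
[cite: Balaban1985BackgroundPropagators, Thm 3.7 (3.90) p.409, Thm 3.9 (3.98)–(3.99) pp.412–413, Thm 3.10 (3.107)–(3.108) pp.415–416, Thm 3.11 p.416, Thm 3.12 p.423,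
Thm 3.13 p.426, (3.19) p.393, (3.40) p.397, (3.35)–(3.36) p.396, bookkeeping] -/
theorem pinsE_of_eq {𝔈 : ExpsY N θ Mstar}
    (h𝔈 : 𝔈 = expsYOfRecordV3Par N θ Mstar 𝔏 𝔈₀ R₁ R₂ bI parA parH 𝔮 𝔮s α' r39 B39 p q p3 q3 pM qM H O near 𝔬A rdA 𝔬12) :
    (∀ x : MemberY θ.d₆ θ.ℓ₆ θ.hd' θ.hL' θ.b₀ θ.b₁ Mstar, rwKernelExpansionR R₁ R₂ (𝔈 x).EK39 =
        EK39OfOpsBlkVia (oneCubeOps39 (geo9Y x) (bg9YR (Matrix (Fin N) (Fin N) ℂ) (specialUnitaryUnits (Fin N)) R₁ R₂ x)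
          (blk39F (Matrix (Fin N) (Fin N) ℂ) x.toKIdx (bI x)) (L39 x.toKIdx (parA x) (𝔏 x).Gp)) (oneCubeReading39 _) (θ.d₆ + 1)
          (2 * (1 * B39) * rowConst261 (geo9Y (d := θ.d₆) (ℓ := θ.ℓ₆) (hd := θ.hd') (hL := θ.hL') (b₀ := θ.b₀) (b₁ := θ.b₁) (Mstar := Mstar)) (α' * r39))
          ((1 - α') * r39) (repSite39F x.toKIdx (bI x))) ∧
      (∀ x : MemberY θ.d₆ θ.ℓ₆ θ.hd' θ.hL' θ.b₀ θ.b₁ Mstar, (𝔈 x).PosDef =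
        PosDefOfOps (ops311YQ x (𝔏 x) (parA x) (𝔮 x) (𝔮s x) (proofLettersGA (𝔏 x)))) ∧
      (∀ x : MemberY θ.d₆ θ.ℓ₆ θ.hd' θ.hL' θ.b₀ θ.b₁ Mstar, rwExpansionR R₁ R₂ (𝔈 x).E37 =
        E37YPairMDir (bg := (bg9YR (Matrix (Fin N) (Fin N) ℂ) (specialUnitaryUnits (Fin N)) R₁ R₂)) (2 * (θ.d₆ + 1))
          (nbrCountY θ.d₆ θ.ℓ₆ θ.hd' θ.hL' θ.b₀ θ.b₁ 2) (Real.sqrt ((θ.d₆ + 1) * Fintype.card (TrIdx N))) ((θ.d₆ + 1 : ℕ) : ℝ) p q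
          (⟨p3.N3, 2 * p3.B3, 0⟩ : PairPrims) (⟨q3.N3, 2 * q3.B3, 0⟩ : PairPrims) pM qM
          (opsWalkYO x (trBasis N) (bg9YR (Matrix (Fin N) (Fin N) ℂ) (specialUnitaryUnits (Fin N)) R₁ R₂ x) (fun U => U) (parA x) (bI x) (O x))
          (dirOpsWalkYO x (trBasis N) (bg9YR (Matrix (Fin N) (Fin N) ℂ) (specialUnitaryUnits (Fin N)) R₁ R₂ x) (fun U => U) (parA x) (bI x) (O x))
          (dirLettersWalkYO x (trBasis N) (bg9YR (Matrix (Fin N) (Fin N) ℂ) (specialUnitaryUnits (Fin N)) R₁ R₂ x) (fun U => U) (parA x) (bI x) (O x))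
          (rdWalkYO x (bg9YR (Matrix (Fin N) (Fin N) ℂ) (specialUnitaryUnits (Fin N)) R₁ R₂ x) (fun U => U) (parA x) (near x)) (H x)
          (kernelFamilyR R₁ R₂
            (kernelFamilyS x.toKIdx (bg9Y (Matrix (Fin N) (Fin N) ℂ) (specialUnitaryUnits (Fin N)) x) (fun U => U) (𝔏 x).Gp (parH x)))) ∧
      (∀ x : MemberY θ.d₆ θ.ℓ₆ θ.hd' θ.hL' θ.b₀ θ.b₁ Mstar, rwExpansionR R₁ R₂ (𝔈 x).E310 =
        E310YPairM (bg := (bg9YR (Matrix (Fin N) (Fin N) ℂ) (specialUnitaryUnits (Fin N)) R₁ R₂)) (2 * (θ.d₆ + 1))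
          (nbrCountY θ.d₆ θ.ℓ₆ θ.hd' θ.hL' θ.b₀ θ.b₁ 2) (Real.sqrt ((θ.d₆ + 1) * Fintype.card (TrIdx N))) ((θ.d₆ + 1 : ℕ) : ℝ) p q
          (⟨p3.N3, 2 * p3.B3, 0⟩ : PairPrims) (⟨q3.N3, 2 * q3.B3, 0⟩ : PairPrims) pM qM (𝔬A x) (rdA x) (H x)
          (kernelFamilyR R₁ R₂
            (kernelFamilyB x.toKIdx (bg9Y (Matrix (Fin N) (Fin N) ℂ) (specialUnitaryUnits (Fin N)) x) (fun U => U) (𝔏 x).GA (𝔏 x).parB))) ∧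
      (∀ x : MemberY θ.d₆ θ.ℓ₆ θ.hd' θ.hL' θ.b₀ θ.b₁ Mstar, (𝔈 x).HasRWExp = HasRWExpOfOps (ops312RY (𝔬12 x))) ∧
      (∀ x : MemberY θ.d₆ θ.ℓ₆ θ.hd' θ.hL' θ.b₀ θ.b₁ Mstar, (𝔈 x).HasRWExpH = HasRWExpHOfOps (ops312RY (𝔬12 x))) ∧
      (∀ x : MemberY θ.d₆ θ.ℓ₆ θ.hd' θ.hL' θ.b₀ θ.b₁ Mstar, (𝔈 x).PosDefK = PosDefKOfOps (ops312RY (𝔬12 x))) := by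
  subst h𝔈; exact ⟨fun _ => rfl, fun _ => rfl, fun _ => rfl, fun _ => rfl, fun _ => rfl, fun _ => rfl, fun _ => rfl⟩

end Faces

end Literature.MathematicalPhysics.QuantumFieldTheory.Balaban1983to89.Node00.OpsYExpsOfRecordV3Par

end
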